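/-
POST-BIRTH FILE (planner g3 2026-08-25; v5 planner g5: + BC5 rung stub `stub_H10_rung_betaU_corner`; v6/v7 planner g6 2026-08-25 (v7: + S5 `CountPairsOffset` as STUB 0 feeding STUB 1, per HOME/planner-g5/S5-filing.md step 3; v8: the rung/S5 stubs name the ROUTE DECLS filed at rev 1 — no local copies; v9: stub signatures spelled FULLY-QUALIFIED so the gate's bc6 cone reader matches item decls textually): referee FINDING-1
(HOME/REF-CHECK.md §13) answered by option (α): the FIRST plan-only rung is the COMPACT-BOX corner `stub_H10_rung_compact : H10RungCompactBox`
(single-scale, uniform constants on a compact (β, μ) box — 3–6 sd), the βU ≤ κ corner `stub_H10_rung_betaU_corner` stays as the SECOND rung,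
RE-PRICED 12–20 sd and re-assigned to a multiscale technique (its radius is NOT reachable by the single-scale engine: C(β, μ) ≳ β^{5/2}).
Body CHECKED before birth against the gate render via bc/birth-v6-check.lean; this file itself elaborates only once the route file exists):
BC3 birth skeleton of crux K1 = `H10TwoPointLimit` of route KLProgramme. After `ledger route open … KLProgramme …` succeeds:
  lean check --json bc/post-birth/H10TwoPointLimit_birth.lean      (expect rc 0, sorries = 5 = the five stubs, none elsewhere; stub types are NAMED constants — skeleton lint `skeleton.extra-hypothesis` otherwise)
  ledger crux write <K1-item> Lines/birth.lean --file bc/post-birth/H10TwoPointLimit_birth.lean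
  ledger skeleton check $(ledger crux dir <K1-item>)/Lines/birth.lean --crux <K1-item>
-/
import Summits.HubbardSuperconductivity.HubbardSuperconductivity.Theses.KLProgramme

open Filter Topology
open Literature.MathematicalPhysics.QuantumLattice Literature.Probability.LatticeModels

namespace Summit.HubbardSuperconductivity.HubbardSuperconductivity.Cruxes.H10TwoPointLimit.Birth

open Summit.HubbardSuperconductivity.HubbardSuperconductivity.Theses.KLProgramme

/-- K1 in the μ-parametrisation on the ANALYSIS window [μa, μb] (what the analyst proves: the BGM-scale theorem at fixed μ with
constants uniform on the compact window; DECOMP C5a = Paper 1). -/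
def H10TwoPointLimitMu (μa μb : ℝ) : Prop :=
  ∃ U₀ a : ℝ, 0 < U₀ ∧ 0 < a ∧
    ∀ μ ∈ Set.Icc μa μb, ∀ U β : ℝ, 0 < U → U ≤ U₀ → 0 < β → β ≤ Real.exp (a / U) →
      ∀ (x y : Literature.Probability.LatticeModels.Site 2) (σ σ' : Fin 2), ∃ S : ℂ,
        Filter.Tendsto (fun L : ℕ => Literature.MathematicalPhysics.QuantumLattice.hubbardThermalTwoPoint β U μ L x y σ σ')
          Filter.atTop (nhds S)

/-- The analysis-window instance of K1 as a NAMED constant (the skeleton lint matches composition hypotheses to stubs by name). -/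
def H10AnalysisWindow : Prop := H10TwoPointLimitMu (-1) (-0.15)

/-! STUB 0's statement is the route support item `CountPairsOffset` (decl of Theses/KLProgramme.lean since rev 1, commit 9713dcdd4f16) —
named here BY THE ROUTE DECL (v8), so the registered stub signature is the item itself. -/

/-- STUB 0 (DECOMP S5 = C5a(i), 10–14 sd, provable now on the landed band-geometry toolbox): the arbitrary-offset pair count. -/
theorem stub_countPairsOffset : Summit.HubbardSuperconductivity.HubbardSuperconductivity.Theses.KLProgramme.CountPairsOffset := by
  sorry

/-- STUB 1 (the analysis proper; DECOMP C5a(ii)–(iii), 30–45 sd minus S5): GIVEN the offset pair count (the phase-space input of every 2n-leg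
sector sum), the BGM-scale two-point limit on the analysis window [−1, −0.15] (BGM 2006 §2–3 engine re-run at intermediate filling: sector
counting via `CountPairsOffset`, the umklapp-corner normal form App. C for the quadratic part, DR 2000 derivative bounds). -/
theorem stub_H10_mu_of_count : Summit.HubbardSuperconductivity.HubbardSuperconductivity.Theses.KLProgramme.CountPairsOffset → H10AnalysisWindow := by
  sorry

/-- STUB 2 (= route support item S0 `MuOfDopingWindow`; DECOMP S0, 2–3 sd, Lean now): μ([0.10, 0.35]) ⊂ [−1, −0.15]. -/
theorem stub_muWindow : Summit.HubbardSuperconductivity.HubbardSuperconductivity.Theses.KLProgramme.MuOfDopingWindow := by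
  sorry

/-! BC5 FIRST RUNG of K1 (v6, DECOMP §8(f) as amended by REF-CHECK §13 FINDING-1; plan-only, T3): the COMPACT-BOX corner of K1 made UNIFORM on
the doping window — `∀ B > 0, ∃ U₀ > 0, ∀ δ ∈ [0.10, 0.35], ∀ 0 < U ≤ U₀, ∀ 0 < β ≤ B, the two-point limit exists`. Not a theorem of the tree
(the tree has the corner only POINTWISE in (β, μ): `hubbardTwoPoint_limit_exists_of_small_coupling` — radius r(β, μ) with no uniformity — plus the
high-temperature strip β ≤ betaHT `exists_tendsto_hubbardThermalTwoPoint_of_le_betaHT`); technique: the in-tree single-scale chain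
`tendsto_hubbardThermalTwoPoint_of_truncated_bounds` + `exists_norm_hubbardTorusTruncatedCoeff_le_geometric`, with the constants C(β, μ), S(β, μ)
bounded uniformly on the compact box (β, μ) ∈ [betaHT, B] × [−1, −0.15] (continuity / explicit monotone majorants in β; `MuOfDopingWindow` places
μ(δ)); U₀(B) := inf over the box of the radius. 3–6 sd, provable now; filed as route support item `H10RungCompactBox` (rev 1) — STUB 3 names the ROUTE DECL (v8). -/

/-- STUB 3 (BC5 first rung, plan-only; the route's first prover target under T3-plan-only). -/
theorem stub_H10_rung_compact : Summit.HubbardSuperconductivity.HubbardSuperconductivity.Theses.KLProgramme.H10RungCompactBox := by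
  sorry

/-- The compact-box rung IS a special case of the crux: given K1's (U₀, a), for the box β ≤ B take U₀(B) := min U₀ (a / max (log B) 1), so that
β ≤ B = e^{log B} ≤ e^{max (log B) 1} ≤ e^{a/U}. Recorded so the skeleton shows the rung's place. -/
theorem H10RungCompactBox_of_H10 : H10TwoPointLimit → H10RungCompactBox := by
  rintro ⟨U₀, a, hU₀, ha, H⟩ B hB
  have hMpos : 0 < max (Real.log B) 1 := lt_of_lt_of_le one_pos (le_max_right _ _)
  refine ⟨min U₀ (a / max (Real.log B) 1), lt_min hU₀ (div_pos ha hMpos), ?_⟩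
  intro δ hδ U β hU hUle hβ hβB x y σ σ'
  have hU₀' : U ≤ U₀ := hUle.trans (min_le_left _ _)
  have hUM : U * max (Real.log B) 1 ≤ a := (le_div_iff₀ hMpos).mp (hUle.trans (min_le_right _ _))
  have h1 : max (Real.log B) 1 ≤ a / U := by
    rw [le_div_iff₀ hU, mul_comm]; exact hUM
  have h2 : β ≤ Real.exp (a / U) :=
    calc β ≤ B := hβB
      _ = Real.exp (Real.log B) := (Real.exp_log hB).symm
      _ ≤ Real.exp (max (Real.log B) 1) := Real.exp_le_exp.mpr (le_max_left _ _)
      _ ≤ Real.exp (a / U) := Real.exp_le_exp.mpr h1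
  exact H δ hδ U β hU hU₀' hβ h2 x y σ σ'

/-! BC5 SECOND RUNG of K1 (v5 rung, RE-PRICED in v6 after REF-CHECK §13 FINDING-1): the βU-CORNER of K1 made UNIFORM on the doping window —
`∃ U₀ κ > 0, ∀ δ ∈ [0.10, 0.35], ∀ 0 < U ≤ U₀, ∀ β > 0, β·U ≤ κ → the two-point limit exists`. Not a theorem of the tree. NOT reachable by the
single-scale engine (its radius is ∝ (β·C(β, μ)·S(β, μ))⁻¹ with C(β, μ) ≳ β^{5/2}, so r(β) ≪ κ/β): βU ≤ κ is the true convergence range of the bare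
U-expansion only after a MULTISCALE resummation of the frequency axis (an isotropic, sector-free Gallavotti–Nicolò tree expansion down to scale
1/β, no Fermi-surface sectors needed since βU ≤ κ keeps every running coupling O(κ); equivalently the C5a engine run in the sub-regime U·log β → 0).
Price 12–20 sd (was 3–6); it is the natural half-way house between the compact-box rung and K1 itself; filed as route support item `H10RungBetaUCorner` (rev 1) — STUB 4 names the ROUTE DECL (v8). -/

/-- STUB 4 (BC5 second rung, plan-only; multiscale, 12–20 sd). -/
theorem stub_H10_rung_betaU_corner : Summit.HubbardSuperconductivity.HubbardSuperconductivity.Theses.KLProgramme.H10RungBetaUCorner := by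
  sorry

/-- The βU rung IS a special case of the crux (κ := a, since a/U ≤ e^{a/U}); recorded so the skeleton shows the rung's place. -/
theorem H10RungBetaUCorner_of_H10 : H10TwoPointLimit → H10RungBetaUCorner := by
  rintro ⟨U₀, a, hU₀, ha, H⟩
  refine ⟨U₀, a, hU₀, ha, ?_⟩
  intro δ hδ U β hU hUle hβ hβU x y σ σ'
  have h1 : β ≤ a / U := by rw [le_div_iff₀ hU]; exact hβU
  exact H δ hδ U β hU hUle hβ (h1.trans ((le_add_of_nonneg_right zero_le_one).trans (Real.add_one_le_exp _))) x y σ σ'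

/-- The second rung implies the first one on bounded boxes only through K1-type information, so no implication between the two rungs is
claimed here; both are special cases of the crux and both are strictly outside the tree's known regime (pointwise radius / HT strip). -/
theorem H10Rungs_of_H10 : H10TwoPointLimit → H10RungCompactBox ∧ H10RungBetaUCorner :=
  fun h => ⟨H10RungCompactBox_of_H10 h, H10RungBetaUCorner_of_H10 h⟩

/-- Composition: the crux BY NAME from the stubs `stub_countPairsOffset` (S5) → `stub_H10_mu_of_count` (K1 on the analysis window, given the count) and `stub_muWindow` (S0), USED INSIDE the
proof (the skeleton lint `#h21_check_skeleton` admits as hypotheses only registered obligations by name; stubs enter as the sorried theorems they are —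
when both land this theorem is the sorry-free proof of the crux). Pure bookkeeping: instantiate μ := μ(δ). -/
theorem H10TwoPointLimit_of : H10TwoPointLimit := by
  have H : H10AnalysisWindow := stub_H10_mu_of_count stub_countPairsOffset
  have hW : MuOfDopingWindow := stub_muWindow
  unfold H10AnalysisWindow H10TwoPointLimitMu at H
  unfold H10TwoPointLimit
  obtain ⟨U₀, a, hU₀, ha, H'⟩ := H
  refine ⟨U₀, a, hU₀, ha, ?_⟩
  intro δ hδ U β hU hUle hβ hβle x y σ σ'
  exact H' _ (hW δ hδ) U β hU hUle hβ hβle x y σ σ'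

end Summit.HubbardSuperconductivity.HubbardSuperconductivity.Cruxes.H10TwoPointLimit.Birth
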